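import Summits.QuantumFields.YangMills.Theorems.BalabanUVNodesN12ForestOnto
import Summits.QuantumFields.YangMills.Theorems.BalabanUVNodesN12GuardedLinAvgRightInverseBj
import HarnessLib

/-!
# BalabanUVNodes ∕ N12 — THE LINEARISED GAUGE SECTION OF THE FOREST SLICE AT A CURVED BASE FIELD: the residual orbit tangents `X^ξ_b = Ad(U₀,b⁻¹)ξ(b₋) − ξ(b₊)` (`ξ = 0` on the
# constrained representatives) are KILLED by print's linearised multi-scale averaging `Q(U₀)` at every guarded `U₀` (gauge covariance of the averages, [Balaban1985Averaging] (11)),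
# every field is a forest-slice field plus such a tangent (the TWISTED residual decomposition along the forest), hence surjectivity of `DΦ_{U₀}(0)` on the whole space is
# surjectivity FROM THE FOREST SLICE at the curved base — dag-n12-w4's `hsurj` ∕ dag-n12-w1's (45) letter for the tree gauge, with no flatness and no perturbation radius

Cell `pub-ymgap` (HUMAN RULINGS D-0062 ∕ D-0149), WIDTH SEAT `pub-ymgap-dag-n12-w3` g3 (node N12 = [B15]; key K1⁸ `stmt-QuantumFields-26907`, `--kind proof --supports … --as helper`;
count-neutral).  THEOREMS ONLY (0 `def`, 0 `instance`, 0 `sorry`); consumed BY NAME: this seat's `N12RootedForest.forest_F1` ∕ `exists_rootedForest_Bj` (p618645) and `N12ForestOnto.exists_forest_rightInverse_Bj_of_surjective`; dag-n10-w1's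
`N12GuardedLinAvgRightInverseBj.surjective_fderiv_msChart_Bj(_one)` (p620262); n07-w1's
`Node00.LinearisedAveragingAtBackground` (`dIterL`, `qLin`, `hasDerivAt_coeField_iter_of_eventually`), `Node00.CriticalOnFibreTangent.hasDerivAt_coe_expSU_along`, dag-n10-w1's
`N12GuardedChartDerivQLinJunction.fderiv_msChart_apply_eq_suProj_qLin` (p601585), r13's `B16Sect1Backgrounds.iter_gaugeAct` ∕ `toMS`, `BlockAveraging.small_gaugeAct_iff`,
`T4AdjointCovarianceUnitary.specialUnitaryAd`, dag-n10-w1∕n07 `N07CritTangentConverse.smallBelow_of_plaqSmall`, `Node00.coe_mul_star_coe_SU`.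

WHY.  The companion `N12ForestOnto` transfers surjectivity to the forest slice at the FLAT base (residual directions `dξ`) and perturbs.  At the base fields of the N12 chain — minimisers
`U₀` that are near-flat only NEAR `Z` (dag-n12-w5's LOCATED-hU) — the honest statement is the EXACT one at the curved base: in NODE 00's chart `X ↦ U₀·exp X` the tangent at `1` to the
orbit of the residual gauge group (4) `{u : u = 1 on R(𝐁, k)}` is `X^ξ_b = Ad(U₀,b⁻¹)ξ(b₋) − ξ(b₊)`, `ξ|_R = 0`; along the gauge curve `t ↦ U₀^{exp tξ}` every constrained average
`Ū^j(·)(c)` is CONSTANT (`Ū^j(U^u) = Ū^j(U)^{u∘embIter j}` and `u = 1` at `embIter j c₋`, `embIter j c₊`), so `Q_j(U₀)` kills the velocity `ξ(b₋)U₀,b − U₀,b ξ(b₊) = U₀,b·X^ξ_b` (§2);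
and along a rooted forest every field `X` equals such a tangent on the path bonds for a unique root-normalised `ξ` (§1, the twisted telescoping `ξ(x″) = β⁻¹(α ξ(x′) − X_b)` ∕
`α⁻¹(X_b + β ξ(x′))` down the tree).  Hence `X − X^ξ` lies in the forest slice and has the same image under `DΦ_{U₀}(0)` (§3).

CONTENTS.  §1 ★★ `exists_twisted_residual_of_forest` (any additive group `V`, any bond families of additive automorphisms `α_b, β_b`: `X_b = α_b ξ(b₋) − β_b ξ(b₊)` on every path bond, `ξ|_R = 0`).
§2 `smallBelow_gaugeAct_iff` (the guard is gauge invariant), ★ `hasDerivAt_coeField_gaugeAct_expSU` (velocity `ξ(b₋)U₀,b − U₀,b ξ(b₊)` of the gauge curve), ★★★ `dIterL_orbitTangent_apply_eq_zero`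
(`Q_j(U₀)[ξ(b₋)U₀,b − U₀,b ξ(b₊)](c) = 0` when `ξ(embIter j c₋) = ξ(embIter j c₊) = 0`, guard `SmallBelow … j U₀`), ★★ `qLin_orbitTangent_eq_zero` (the same for n07-w1's `qLin j U₀ X^ξ c`).
§3 ★★★ `exists_forest_preimage_of_surjective_curved` (at a guarded `U₀` with its own datum `M˙(U₀)`: `DΦ_{U₀}(0)` onto ⟹ every target is hit FROM THE FOREST SLICE; rooted forest with (F1),
roots ⊇ `R(𝐁, k)`), ★★ `exists_forest_rightInverse_of_surjective_curved` (a LINEAR right inverse valued in the slice), ★★ `exists_forest_rightInverse_Bj_of_surjective_curved` (the record).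
§4 AT THE RECORD WITH THE SURJECTIVITY DISCHARGED BY NAME (dag-n10-w1's `N12GuardedLinAvgRightInverseBj.surjective_fderiv_msChart_Bj_one` ∕ `surjective_fderiv_msChart_Bj`, p620262):
★★★ `exists_forest_rightInverse_Bj_atRecord` (`2 ≤ M₁`, `1 ≤ k ≤ m + K`, cover divisibility ⟹ `∃ path H`: (F1) ∧ (F2) ∧ (TREE) ∧ `H` slice-valued ∧ `DΦ♭(0) ∘ H = id` at the FLAT chart of record —
hypothesis-free), ★★★ `exists_forest_rightInverse_Bj_nearFlat_atRecord` (the same forest; ONE radius `ρ′ > 0`; at every guarded `U₀` with `‖↑U₀ − 1‖ < ρ′` a slice-valued right inverse of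
`DΦ_{U₀}(0)` — §3 fed by `surjective_fderiv_msChart_Bj`).

HONEST FRAMING.  Bookkeeping: gauge covariance of the averages, the derivative of a constant curve, telescoping along a forest, finite-dimensional linear algebra; the surjectivity of
`DΦ_{U₀}(0)` on the whole space is DISPLAYED (dag-n10-w1's WAY (ii) ∕ H3 at the record); the guard `SmallBelow … k U₀` + `stokesConst·t₀ < δ_N` is NODE 00's standing small-field
hypothesis; no constants; nothing of Bałaban's estimates asserted; N12 NOT discharged; K1⁸ NOT closed; counts unmoved (typed 28∕28 · discharged 5∕27); one finite 𝕋⁴ programme at fixed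
ε — R4 closes the conditional rung `BalabanLadder.UV` only; the Yang–Mills mass gap (Clay) is NOT proved by any of this; nothing continuum ∕ ℝ⁴ ∕ OS.
-/

noncomputable section

namespace Summit.QuantumFields.YangMills.BalabanUVNodes.N12ForestSliceCurved

open scoped BigOperators Matrix.Norms.L2Operator Topology
open Filter
open Literature.MathematicalPhysics.QuantumFieldTheory.Balaban1983to89
open T4Continuum
open B15DeterminingSets
open BlockAveraging (blockAvg)
open ExpMeanLog (expMeanLogSU deltaSU)
open T4AdjointCovarianceUnitary (lieSU expSU specialUnitaryAd coe_specialUnitaryAd mem_lieSU_iff)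
open Node00
open B16Sect1Backgrounds (toMS iter_gaugeAct)
open Summit.QuantumFields.YangMills.Theorems.BlockAvgCorrector (stokesConst)
open Summit.QuantumFields.YangMills.BalabanUVNodes.N12GuardedChartDerivQLinJunction (fderiv_msChart_apply_eq_suProj_qLin)
open Summit.QuantumFields.YangMills.BalabanUVNodes.N12RootedForest (forest_F1 exists_rootedForest_Bj)
open Summit.QuantumFields.YangMills.BalabanUVNodes.N07CritTangentConverse (smallBelow_of_plaqSmall)

variable {P : Params} {j : ℕ}

/-! ## §1 The twisted residual decomposition along a rooted forest -/

section Twisted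

/-- ★★ **THE TWISTED RESIDUAL DECOMPOSITION**: for bond families of additive automorphisms `α_b`, `β_b` of `V` and a rooted forest with (F1) and (F2) at `R`, every bond field `X` agrees ON
EVERY PATH BOND with the twisted gradient `b ↦ α_b ξ(b₋) − β_b ξ(b₊)` of a site function `ξ` vanishing on `R` (telescoping down the tree: `ξ(x″) = β_b⁻¹(α_b ξ(x′) − X_b)` along a forward
step, `ξ(x″) = α_b⁻¹(X_b + β_b ξ(x′))` along a backward one).  `α = β = id` is `N12RootedForest.exists_residual_of_forest`; `α_b = Ad(U₀,b⁻¹)`, `β = id` is the orbit tangent of §3.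
[cite: Balaban1985Variational, (4) p.278, (16)–(18) p.280; Balaban1985RegularSpaces, (1.19) p.79] -/
theorem exists_twisted_residual_of_forest {R : Set (Site P j)} {path : Site P j → List (LStep P j)} (hroot : ∀ r ∈ R, path r = [])
    (hF1 : ∀ x, ∀ s ∈ path x, ∃ x' x'' : Site P j, path x'' = path x' ++ [s] ∧
      (s.fwd = true → s.bond.src = x' ∧ s.bond.tgt = x'') ∧ (s.fwd = false → s.bond.src = x'' ∧ s.bond.tgt = x'))
    {V : Type*} [AddCommGroup V] (α β : PBond P j → V ≃+ V) (X : PBond P j → V) :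
    ∃ ξ : Site P j → V, (∀ r ∈ R, ξ r = 0) ∧ ∀ x, ∀ s ∈ path x, X s.bond = α s.bond (ξ s.bond.src) - β s.bond (ξ s.bond.tgt) := by
  refine ⟨fun x => (path x).foldl (fun v s => if s.fwd then (β s.bond).symm (α s.bond v - X s.bond) else (α s.bond).symm (X s.bond + β s.bond v)) 0,
    fun r hr => by simp [hroot r hr], ?_⟩
  intro x s hs
  obtain ⟨x', x'', hp, hfwd, hbwd⟩ := hF1 x s hs
  have hstep : (path x'').foldl (fun v s => if s.fwd then (β s.bond).symm (α s.bond v - X s.bond) else (α s.bond).symm (X s.bond + β s.bond v)) 0 =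
      (if s.fwd then (β s.bond).symm (α s.bond ((path x').foldl (fun v s => if s.fwd then (β s.bond).symm (α s.bond v - X s.bond)
        else (α s.bond).symm (X s.bond + β s.bond v)) 0) - X s.bond)
      else (α s.bond).symm (X s.bond + β s.bond ((path x').foldl (fun v s => if s.fwd then (β s.bond).symm (α s.bond v - X s.bond)
        else (α s.bond).symm (X s.bond + β s.bond v)) 0))) := by
    rw [hp, List.foldl_append, List.foldl_cons, List.foldl_nil]
  beta_reduce
  cases h : s.fwd
  · obtain ⟨hs, ht⟩ := hbwd h
    rw [hs, ht, hstep, h]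
    simp only [Bool.false_eq_true, if_false, AddEquiv.apply_symm_apply, add_sub_cancel_right]
  · obtain ⟨hs, ht⟩ := hfwd h
    rw [hs, ht, hstep, h]
    simp only [if_true, AddEquiv.apply_symm_apply, sub_sub_cancel]

end Twisted

/-! ## §2 The linearised averaging kills the residual orbit tangents at a guarded base -/

section Orbit

variable {N : ℕ} [NeZero N]

/-- The small-field guard below `k` is gauge invariant (`Ū^i(U^u) = Ū^i(U)^{u ∘ embIter i}`, `small_gaugeAct_iff`; `k ≤ m + K`). [cite: Balaban1985Averaging, (11) p.19; Balaban1987RG1, (0.4) p.253] -/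
theorem smallBelow_gaugeAct_iff {k : ℕ} (hk : k ≤ P.m + P.K) (u : GaugeTransf P 0 (SU N)) (U : GaugeField P 0 (SU N)) :
    SmallBelow (fun i => blockAvg (P := P) (j := i) expMeanLogSU) k (GaugeField.gaugeAct u U) ↔
      SmallBelow (fun i => blockAvg (P := P) (j := i) expMeanLogSU) k U := by
  refine forall_congr' fun i => forall_congr' fun hi => forall_congr' fun c => ?_
  rw [iter_gaugeAct (fun i => blockAvg (P := P) (j := i) expMeanLogSU) u U i (by omega)]
  exact BlockAveraging.small_gaugeAct_iff _ _ _ c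

/-- ★ **VELOCITY OF THE GAUGE CURVE** `t ↦ U₀^{exp tξ}`: bond-wise `d∕dt (exp(tξ(b₋))·U₀,b·exp(tξ(b₊))⁻¹)|₀ = ξ(b₋)U₀,b − U₀,b ξ(b₊)` (`(expSU Y)⁻¹ = (expSU Y)⋆` and `ξ⋆ = −ξ` on `𝔰𝔲(N)`).
[cite: Balaban1985Averaging, (8) p.18; Balaban1985RegularSpaces, (1.10) p.77 (bookkeeping)] -/
theorem hasDerivAt_coeField_gaugeAct_expSU (U₀ : GaugeField P 0 (SU N)) (ξ : Site P 0 → lieSU (Fin N)) :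
    HasDerivAt (fun t : ℝ => coeField (GaugeField.gaugeAct (fun x => expSU (t • ξ x)) U₀))
      (fun b => (ξ b.src : Matrix (Fin N) (Fin N) ℂ) * (U₀ b : Matrix (Fin N) (Fin N) ℂ) - (U₀ b : Matrix (Fin N) (Fin N) ℂ) * (ξ b.tgt : Matrix (Fin N) (Fin N) ℂ)) 0 := by
  refine hasDerivAt_pi.2 fun b => ?_
  have hray : HasDerivAt (fun t : ℝ => t • ξ) ξ 0 := by
    have h := (hasDerivAt_id (0 : ℝ)).smul_const ξ
    rw [one_smul] at h
    exact h
  have hexp : ∀ x : Site P 0, HasDerivAt (fun t : ℝ => ((expSU (t • ξ x) : SU N) : Matrix (Fin N) (Fin N) ℂ)) (ξ x : Matrix (Fin N) (Fin N) ℂ) 0 :=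
    fun x => hasDerivAt_coe_expSU_along (c := fun t : ℝ => t • ξ x) ((hasDerivAt_pi.1 hray) x) (zero_smul ℝ (ξ x))
  have hstar : HasDerivAt (fun t : ℝ => star ((expSU (t • ξ b.tgt) : SU N) : Matrix (Fin N) (Fin N) ℂ)) (-(ξ b.tgt : Matrix (Fin N) (Fin N) ℂ)) 0 := by
    have h := ((starL' ℝ : Matrix (Fin N) (Fin N) ℂ ≃L[ℝ] Matrix (Fin N) (Fin N) ℂ) : Matrix (Fin N) (Fin N) ℂ →L[ℝ] Matrix (Fin N) (Fin N) ℂ).hasFDerivAt.comp_hasDerivAt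
      (0 : ℝ) (hexp b.tgt)
    have hξ : star (ξ b.tgt : Matrix (Fin N) (Fin N) ℂ) = -(ξ b.tgt : Matrix (Fin N) (Fin N) ℂ) := (mem_lieSU_iff.1 (ξ b.tgt).2).1
    rw [← hξ]
    exact h
  have hprod := ((hexp b.src).mul_const ((U₀ b : SU N) : Matrix (Fin N) (Fin N) ℂ)).mul hstar
  have hfun : (fun t : ℝ => coeField (GaugeField.gaugeAct (fun x => expSU (t • ξ x)) U₀) b) =
      fun t : ℝ => ((expSU (t • ξ b.src) : SU N) : Matrix (Fin N) (Fin N) ℂ) * ((U₀ b : SU N) : Matrix (Fin N) (Fin N) ℂ) *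
        star ((expSU (t • ξ b.tgt) : SU N) : Matrix (Fin N) (Fin N) ℂ) := by
    funext t
    rfl
  rw [hfun]
  refine hprod.congr_deriv ?_
  simp only [zero_smul, expSU_zero, OneMemClass.coe_one, star_one, mul_one, one_mul, mul_neg, sub_eq_add_neg]

/-- ★★★ **`Q_j(U₀)` KILLS THE RESIDUAL ORBIT TANGENTS.**  At a base field `U₀` with the small-field guard below `j` (`j ≤ m + K`), for every `ξ : T_η → 𝔰𝔲(N)` vanishing at the centres
`embIter j c₋`, `embIter j c₊` of the two ends of a level-`j` bond `c`: `Q_j(U₀)[b ↦ ξ(b₋)U₀,b − U₀,b ξ(b₊)](c) = 0` — the level-`j` average of the gauge curve `U₀^{exp tξ}` at `c` is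
`(exp tξ(embIter j c₋))·Ū^j(U₀)(c)·(exp tξ(embIter j c₊))⁻¹ = Ū^j(U₀)(c)`, constant in `t` ([Balaban1985Averaging] (11) «Ū^u = (Ū)^u»), and `Q_j(U₀)` of the velocity is the velocity
of the averages (`hasDerivAt_coeField_iter_of_eventually`; the guard holds along the curve by gauge invariance). [cite: Balaban1985Averaging, (11) p.19; Balaban1985Variational, (3)–(4) p.278, (44) p.285; Balaban1987RG1, (0.21) p.256] -/
theorem dIterL_orbitTangent_apply_eq_zero {j : ℕ} (hj : j ≤ P.m + P.K) {U₀ : GaugeField P 0 (SU N)}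
    (hsb : SmallBelow (fun i => blockAvg (P := P) (j := i) expMeanLogSU) j U₀) (ξ : Site P 0 → lieSU (Fin N)) (c : PBond P j)
    (hsrc : ξ (embIter j c.src) = 0) (htgt : ξ (embIter j c.tgt) = 0) :
    dIterL j (coeField U₀) (fun b => (ξ b.src : Matrix (Fin N) (Fin N) ℂ) * (U₀ b : Matrix (Fin N) (Fin N) ℂ) -
      (U₀ b : Matrix (Fin N) (Fin N) ℂ) * (ξ b.tgt : Matrix (Fin N) (Fin N) ℂ)) c = 0 := by
  have hev : ∀ᶠ t in 𝓝 (0 : ℝ), SmallBelow (fun i => blockAvg (P := P) (j := i) expMeanLogSU) j (GaugeField.gaugeAct (fun x => expSU (t • ξ x)) U₀) :=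
    Eventually.of_forall fun t => (smallBelow_gaugeAct_iff hj _ U₀).2 hsb
  have hD := hasDerivAt_coeField_iter_of_eventually (k := j) (Γ := fun t : ℝ => GaugeField.gaugeAct (fun x => expSU (t • ξ x)) U₀)
    (hasDerivAt_coeField_gaugeAct_expSU U₀ ξ) hev
  have hΓ0 : GaugeField.gaugeAct (fun x => expSU ((0 : ℝ) • ξ x)) U₀ = U₀ := by
    funext b
    simp only [zero_smul, expSU_zero, GaugeField.gaugeAct, inv_one, one_mul, mul_one]
  simp only [hΓ0] at hD
  -- the `c`-component of `t ↦ ↑Ū^j(U₀^{exp tξ})` is constant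
  have hconst : (fun t : ℝ => coeField (Averaging.iter (fun i => blockAvg (P := P) (j := i) expMeanLogSU) j (GaugeField.gaugeAct (fun x => expSU (t • ξ x)) U₀)) c) =
      fun _ => coeField (Averaging.iter (fun i => blockAvg (P := P) (j := i) expMeanLogSU) j U₀) c := by
    funext t
    rw [iter_gaugeAct (fun i => blockAvg (P := P) (j := i) expMeanLogSU) _ U₀ j hj, coeField_apply, coeField_apply]
    simp only [GaugeField.gaugeAct, toMS, hsrc, htgt, smul_zero, expSU_zero, inv_one, one_mul, mul_one]
  have hc : HasDerivAt (fun t : ℝ => coeField (Averaging.iter (fun i => blockAvg (P := P) (j := i) expMeanLogSU) j (GaugeField.gaugeAct (fun x => expSU (t • ξ x)) U₀)) c)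
      (dIterL j (coeField U₀) (fun b => (ξ b.src : Matrix (Fin N) (Fin N) ℂ) * (U₀ b : Matrix (Fin N) (Fin N) ℂ) -
        (U₀ b : Matrix (Fin N) (Fin N) ℂ) * (ξ b.tgt : Matrix (Fin N) (Fin N) ℂ)) c) 0 := (hasDerivAt_pi.1 hD) c
  rw [hconst] at hc
  exact hc.unique (hasDerivAt_const (0 : ℝ) _)

/-- ★★ **THE SAME IN n07-w1's LEFT-TRIVIALISED READING**: `qLin j U₀ X^ξ c = 0` for the orbit tangent `X^ξ_b = Ad(U₀,b⁻¹)ξ(b₋) − ξ(b₊)` (`U₀,b·X^ξ_b = ξ(b₋)U₀,b − U₀,b ξ(b₊)`), `ξ`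
vanishing at `embIter j c₋` and `embIter j c₊`, guard below `j`. [cite: Balaban1985Variational, (3)–(4) p.278, (44) p.285; Balaban1985Averaging, (11) p.19] -/
theorem qLin_orbitTangent_eq_zero {j : ℕ} (hj : j ≤ P.m + P.K) {U₀ : GaugeField P 0 (SU N)}
    (hsb : SmallBelow (fun i => blockAvg (P := P) (j := i) expMeanLogSU) j U₀) (ξ : Site P 0 → lieSU (Fin N)) (c : PBond P j)
    (hsrc : ξ (embIter j c.src) = 0) (htgt : ξ (embIter j c.tgt) = 0) :
    qLin j U₀ (fun b => specialUnitaryAd (U₀ b)⁻¹ (ξ b.src) - ξ b.tgt) c = 0 := by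
  have hvel : (fun b : PBond P 0 => ((U₀ b : SU N) : Matrix (Fin N) (Fin N) ℂ) *
      ((specialUnitaryAd (U₀ b)⁻¹ (ξ b.src) - ξ b.tgt : lieSU (Fin N)) : Matrix (Fin N) (Fin N) ℂ)) =
      fun b => (ξ b.src : Matrix (Fin N) (Fin N) ℂ) * (U₀ b : Matrix (Fin N) (Fin N) ℂ) - (U₀ b : Matrix (Fin N) (Fin N) ℂ) * (ξ b.tgt : Matrix (Fin N) (Fin N) ℂ) := by
    funext b
    have hinv : (((U₀ b)⁻¹ : SU N) : Matrix (Fin N) (Fin N) ℂ) = star ((U₀ b : SU N) : Matrix (Fin N) (Fin N) ℂ) := rfl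
    rw [Submodule.coe_sub, coe_specialUnitaryAd, hinv, star_star, mul_sub, ← mul_assoc, ← mul_assoc, coe_mul_star_coe_SU, one_mul]
  rw [qLin_apply, hvel, dIterL_orbitTangent_apply_eq_zero hj hsb ξ c hsrc htgt, mul_zero]

end Orbit

/-! ## §3 Surjectivity from the forest slice at a guarded curved base -/

section Curved

variable {F : T4Family} {N : ℕ} [NeZero N] {K k : ℕ}

/-- ★★★ **SURJECTIVITY FROM THE FOREST SLICE AT A CURVED BASE.**  At a configuration `U₀` with the small-field guard (`t₀`-small iterated averages below `k`, `stokesConst·t₀ < δ_N`) and NODE 00's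
chart with ITS OWN datum `M˙(U₀)`: if `DΦ_{U₀}(0)` is onto on the whole space of fine `𝔰𝔲(N)`-fields, then every target is attained by a field VANISHING ON EVERY PATH BOND of any rooted forest
with (F1) whose roots contain `R(𝐁, k)` — subtract the orbit tangent `X^ξ` of §1 (`α_b = Ad(U₀,b⁻¹)`, `β = id`), which §2 puts in the kernel.  No flatness, no radius.
[cite: Balaban1985Variational, (4) p.278, (16)–(18) p.280, (45)–(48) p.285; Balaban1985Averaging, (11) p.19; Balaban1985RegularSpaces, (1.19) p.79] -/
theorem exists_forest_preimage_of_surjective_curved (𝔹 : DetSet (F.P K)) (hk : k ≤ (F.P K).m + (F.P K).K)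
    {t₀ : ℝ} (ht₀ : 0 < t₀) (hstδ : stokesConst (F.P K) * t₀ < deltaSU (Fin N))
    {U₀ : GaugeField (F.P K) 0 (SU N)} (hsm : ∀ i, i < k → PlaqSmall t₀ (Averaging.iter (avOfRecord F N K) i U₀))
    {path : Site (F.P K) 0 → List (LStep (F.P K) 0)}
    (hroot : ∀ r ∈ {z : Site (F.P K) 0 | ∃ j, j ≤ k ∧ ∃ c ∈ bondsOf (𝔹 j), (z = embIter j c.src ∨ z = embIter j c.tgt)}, path r = [])
    (hF1 : ∀ x, ∀ s ∈ path x, ∃ x' x'' : Site (F.P K) 0, path x'' = path x' ++ [s] ∧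
      (s.fwd = true → s.bond.src = x' ∧ s.bond.tgt = x'') ∧ (s.fwd = false → s.bond.src = x'' ∧ s.bond.tgt = x'))
    (hsurj : Function.Surjective (fderiv ℝ (msChart F N K k 𝔹 (avgFamily (avOfRecord F N K) U₀) U₀) 0))
    (τ : Fin (constrCard 𝔹 k) → lieSU (Fin N)) :
    ∃ X : PBond (F.P K) 0 → lieSU (Fin N), (∀ x, ∀ s ∈ path x, X s.bond = 0) ∧
      fderiv ℝ (msChart F N K k 𝔹 (avgFamily (avOfRecord F N K) U₀) U₀) 0 X = τ := by
  obtain ⟨X₀, hX₀⟩ := hsurj τ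
  obtain ⟨ξ, hξR, hξ⟩ := exists_twisted_residual_of_forest hroot hF1
    (fun b => (specialUnitaryAd (U₀ b)⁻¹).toLinearEquiv.toAddEquiv) (fun _ => AddEquiv.refl _) X₀
  have hsb : SmallBelow (avOfRecord F N K) k U₀ := smallBelow_of_plaqSmall ht₀ hstδ hsm
  have hT : fderiv ℝ (msChart F N K k 𝔹 (avgFamily (avOfRecord F N K) U₀) U₀) 0 (fun b => specialUnitaryAd (U₀ b)⁻¹ (ξ b.src) - ξ b.tgt) = 0 := by
    funext i
    rw [fderiv_msChart_apply_eq_suProj_qLin ht₀ hstδ hsm 𝔹 _ i, Pi.zero_apply]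
    have hj : (((constrEnum 𝔹 k).symm i).1 : ℕ) ≤ k := Nat.le_of_lt_succ ((constrEnum 𝔹 k).symm i).1.isLt
    have hc : ((constrEnum 𝔹 k).symm i).2.1 ∈ bondsOf (𝔹 ((constrEnum 𝔹 k).symm i).1) := ((constrEnum 𝔹 k).symm i).2.2
    rw [qLin_orbitTangent_eq_zero (hj.trans hk) (hsb.mono hj) ξ _ (hξR _ ⟨_, hj, _, hc, Or.inl rfl⟩) (hξR _ ⟨_, hj, _, hc, Or.inr rfl⟩), map_zero]
  refine ⟨fun b => X₀ b - (specialUnitaryAd (U₀ b)⁻¹ (ξ b.src) - ξ b.tgt), fun x s hs => ?_, ?_⟩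
  · have h := hξ x s hs
    show X₀ s.bond - _ = 0
    rw [sub_eq_zero]
    exact h
  · have hsub : (fun b => X₀ b - (specialUnitaryAd (U₀ b)⁻¹ (ξ b.src) - ξ b.tgt)) =
        X₀ - fun b => specialUnitaryAd (U₀ b)⁻¹ (ξ b.src) - ξ b.tgt := rfl
    rw [hsub, map_sub, hX₀, hT, sub_zero]

/-- ★★ **A LINEAR RIGHT INVERSE OF `DΦ_{U₀}(0)` VALUED IN THE FOREST SLICE AT A GUARDED CURVED BASE** ([Balaban1985Variational] (45) for the tree gauge at the base field itself).
[cite: Balaban1985Variational, (45) p.285, (4) p.278; Balaban1985Averaging, (11) p.19; Balaban1985RegularSpaces, (1.19) p.79] -/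
theorem exists_forest_rightInverse_of_surjective_curved (𝔹 : DetSet (F.P K)) (hk : k ≤ (F.P K).m + (F.P K).K)
    {t₀ : ℝ} (ht₀ : 0 < t₀) (hstδ : stokesConst (F.P K) * t₀ < deltaSU (Fin N))
    {U₀ : GaugeField (F.P K) 0 (SU N)} (hsm : ∀ i, i < k → PlaqSmall t₀ (Averaging.iter (avOfRecord F N K) i U₀))
    {path : Site (F.P K) 0 → List (LStep (F.P K) 0)}
    (hroot : ∀ r ∈ {z : Site (F.P K) 0 | ∃ j, j ≤ k ∧ ∃ c ∈ bondsOf (𝔹 j), (z = embIter j c.src ∨ z = embIter j c.tgt)}, path r = [])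
    (hF1 : ∀ x, ∀ s ∈ path x, ∃ x' x'' : Site (F.P K) 0, path x'' = path x' ++ [s] ∧
      (s.fwd = true → s.bond.src = x' ∧ s.bond.tgt = x'') ∧ (s.fwd = false → s.bond.src = x'' ∧ s.bond.tgt = x'))
    (hsurj : Function.Surjective (fderiv ℝ (msChart F N K k 𝔹 (avgFamily (avOfRecord F N K) U₀) U₀) 0)) :
    ∃ H : (Fin (constrCard 𝔹 k) → lieSU (Fin N)) →ₗ[ℝ] (PBond (F.P K) 0 → lieSU (Fin N)),
      (∀ τ, ∀ x, ∀ s ∈ path x, H τ s.bond = 0) ∧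
      ∀ τ, fderiv ℝ (msChart F N K k 𝔹 (avgFamily (avOfRecord F N K) U₀) U₀) 0 (H τ) = τ := by
  let S : Submodule ℝ (PBond (F.P K) 0 → lieSU (Fin N)) :=
    { carrier := {X | ∀ x, ∀ s ∈ path x, X s.bond = 0}
      add_mem' := fun {X Y} hX hY x s hs => by simp only [Pi.add_apply, hX x s hs, hY x s hs, add_zero]
      zero_mem' := fun _ _ _ => rfl
      smul_mem' := fun c X hX x s hs => by simp only [Pi.smul_apply, hX x s hs, smul_zero] }
  set D := fderiv ℝ (msChart F N K k 𝔹 (avgFamily (avOfRecord F N K) U₀) U₀) 0 with hD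
  have hrange : LinearMap.range ((D : (PBond (F.P K) 0 → lieSU (Fin N)) →ₗ[ℝ] (Fin (constrCard 𝔹 k) → lieSU (Fin N))) ∘ₗ S.subtype) = ⊤ := by
    refine LinearMap.range_eq_top.2 fun τ => ?_
    obtain ⟨X, hXS, hX⟩ := exists_forest_preimage_of_surjective_curved 𝔹 hk ht₀ hstδ hsm hroot hF1 hsurj τ
    exact ⟨⟨X, hXS⟩, hX⟩
  obtain ⟨g, hg⟩ := LinearMap.exists_rightInverse_of_surjective _ hrange
  refine ⟨S.subtype ∘ₗ g, fun τ => (g τ).2, fun τ => ?_⟩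
  have h := LinearMap.congr_fun hg τ
  simpa only [LinearMap.comp_apply, LinearMap.id_apply, ContinuousLinearMap.coe_coe] using h

open Literature.MathematicalPhysics.QuantumFieldTheory.Balaban1983to89.B14.Eq213DetSet (Bj)
open Literature.MathematicalPhysics.QuantumFieldTheory.Balaban1983to89.B14.Eq213MaximalDomains (side)

/-- ★★ **THE FOREST RIGHT INVERSE AT THE RECORD's `𝐁_k(Z)`, CURVED BASE**: for every `Z`, the rooted forest of `N12RootedForest.exists_rootedForest_Bj` ((F1), (F2), (TREE)) and, at every
guarded `U₀` where `DΦ_{U₀}(0)` is onto (dag-n10-w1's WAY (ii) ∕ H3, DISPLAYED), a LINEAR right inverse valued in its slice — the same `path` that serves the (β)♭ letters of `N12ForestSlice`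
and the criticality transfer of `B15Prop1AxialGaugeSectionOfForest`. [cite: Balaban1985Variational, (45) p.285, (4) p.278, (16)–(18) p.280; Balaban1988Convergent, (2.2) p.255, (2.13) pp.256–257] -/
theorem exists_forest_rightInverse_Bj_of_surjective_curved {M₁ : ℕ} {Z : Set (Site (F.P K) 0)} (hk : k ≤ (F.P K).m + (F.P K).K) (hk1 : 1 ≤ k)
    (hM : 1 ≤ M₁) (hdiv : side (F.P K).L M₁ k ∣ (F.P K).sitesPerDir 0) :
    ∃ path : Site (F.P K) 0 → List (LStep (F.P K) 0),
      (∀ x, ∀ s ∈ path x, ∃ x' x'' : Site (F.P K) 0, path x'' = path x' ++ [s] ∧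
        (s.fwd = true → s.bond.src = x' ∧ s.bond.tgt = x'') ∧ (s.fwd = false → s.bond.src = x'' ∧ s.bond.tgt = x')) ∧
      (∀ j, j ≤ k → ∀ c ∈ bondsOf ((Bj M₁ Z k : DetSet (F.P K)) j), path (embIter j c.src) = [] ∧ path (embIter j c.tgt) = []) ∧
      (∀ x : Site (F.P K) 0, x ∉ {z : Site (F.P K) 0 | ∃ j, j ≤ k ∧ ∃ c ∈ bondsOf ((Bj M₁ Z k : DetSet (F.P K)) j), (z = embIter j c.src ∨ z = embIter j c.tgt)} →
        ∃ (x' : Site (F.P K) 0) (s : LStep (F.P K) 0), path x = path x' ++ [s] ∧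
          (s.fwd = true → s.bond.src = x' ∧ s.bond.tgt = x) ∧ (s.fwd = false → s.bond.src = x ∧ s.bond.tgt = x')) ∧
      ∀ ⦃t₀ : ℝ⦄, 0 < t₀ → stokesConst (F.P K) * t₀ < deltaSU (Fin N) →
        ∀ U₀ : GaugeField (F.P K) 0 (SU N), (∀ i, i < k → PlaqSmall t₀ (Averaging.iter (avOfRecord F N K) i U₀)) →
          Function.Surjective (fderiv ℝ (msChart F N K k (Bj M₁ Z k) (avgFamily (avOfRecord F N K) U₀) U₀) 0) →
          ∃ H : (Fin (constrCard (Bj M₁ Z k : DetSet (F.P K)) k) → lieSU (Fin N)) →ₗ[ℝ] (PBond (F.P K) 0 → lieSU (Fin N)),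
            (∀ τ, ∀ x, ∀ s ∈ path x, H τ s.bond = 0) ∧
            ∀ τ, fderiv ℝ (msChart F N K k (Bj M₁ Z k) (avgFamily (avOfRecord F N K) U₀) U₀) 0 (H τ) = τ := by
  obtain ⟨path, hF1, hF2, htree⟩ := exists_rootedForest_Bj (Z := Z) hk hk1 hM hdiv
  have hroot : ∀ r ∈ {z : Site (F.P K) 0 | ∃ j, j ≤ k ∧ ∃ c ∈ bondsOf ((Bj M₁ Z k : DetSet (F.P K)) j), (z = embIter j c.src ∨ z = embIter j c.tgt)}, path r = [] := by
    rintro r ⟨j, hj, c, hc, rfl | rfl⟩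
    · exact (hF2 j hj c hc).1
    · exact (hF2 j hj c hc).2
  exact ⟨path, hF1, hF2, htree, fun t₀ ht₀ hstδ U₀ hsm hsurj =>
    exists_forest_rightInverse_of_surjective_curved (Bj M₁ Z k) hk ht₀ hstδ hsm hroot hF1 hsurj⟩

end Curved

/-! ## §4 At the record with the surjectivity discharged by name -/

section AtRecord

open Literature.MathematicalPhysics.QuantumFieldTheory.Balaban1983to89.B14.Eq213DetSet (Bj)
open Literature.MathematicalPhysics.QuantumFieldTheory.Balaban1983to89.B14.Eq213MaximalDomains (side)
open Summit.QuantumFields.YangMills.BalabanUVNodes.N12ForestOnto (exists_forest_rightInverse_Bj_of_surjective)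
open Summit.QuantumFields.YangMills.BalabanUVNodes.N12GuardedLinAvgRightInverseBj (surjective_fderiv_msChart_Bj_one surjective_fderiv_msChart_Bj)

variable {F : T4Family} {N : ℕ} [NeZero N] {K k : ℕ} {M₁ : ℕ} {Z : Set (Site (F.P K) 0)}

/-- ★★★ **THE FOREST RIGHT INVERSE AT THE FLAT CHART OF RECORD, HYPOTHESIS-FREE**: for `𝐁_k(Z)` (every `Z`; `2 ≤ M₁`, `1 ≤ k ≤ m + K`, cover divisibility) a rooted forest `path` with (F1),
(F2), (TREE) at `R(𝐁_k(Z), k)` and a LINEAR right inverse of `DΦ♭(0) = fderiv ℝ (msChart F N K k (Bj M₁ Z k) (M˙1) 1) 0` VALUED IN ITS SLICE — `N12ForestOnto.exists_forest_rightInverse_Bj_of_surjective`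
with its surjectivity letter DISCHARGED by dag-n10-w1's `surjective_fderiv_msChart_Bj_one`.  ([15] (45) for the tree gauge at the flat base, nothing displayed.)
[cite: Balaban1985Variational, (45) p.285, (4) p.278, (16)–(18) p.280; Balaban1988Convergent, (2.2) p.255, (2.13) pp.256–257] -/
theorem exists_forest_rightInverse_Bj_atRecord (hk : k ≤ (F.P K).m + (F.P K).K) (hk1 : 1 ≤ k) (hM2 : 2 ≤ M₁) (hdiv : side (F.P K).L M₁ k ∣ (F.P K).sitesPerDir 0) :
    ∃ (path : Site (F.P K) 0 → List (LStep (F.P K) 0)) (H : (Fin (constrCard (Bj M₁ Z k : DetSet (F.P K)) k) → lieSU (Fin N)) →ₗ[ℝ] (PBond (F.P K) 0 → lieSU (Fin N))),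
      (∀ x, ∀ s ∈ path x, ∃ x' x'' : Site (F.P K) 0, path x'' = path x' ++ [s] ∧
        (s.fwd = true → s.bond.src = x' ∧ s.bond.tgt = x'') ∧ (s.fwd = false → s.bond.src = x'' ∧ s.bond.tgt = x')) ∧
      (∀ j, j ≤ k → ∀ c ∈ bondsOf ((Bj M₁ Z k : DetSet (F.P K)) j), path (embIter j c.src) = [] ∧ path (embIter j c.tgt) = []) ∧
      (∀ x : Site (F.P K) 0, x ∉ {z : Site (F.P K) 0 | ∃ j, j ≤ k ∧ ∃ c ∈ bondsOf ((Bj M₁ Z k : DetSet (F.P K)) j), (z = embIter j c.src ∨ z = embIter j c.tgt)} →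
        ∃ (x' : Site (F.P K) 0) (s : LStep (F.P K) 0), path x = path x' ++ [s] ∧
          (s.fwd = true → s.bond.src = x' ∧ s.bond.tgt = x) ∧ (s.fwd = false → s.bond.src = x ∧ s.bond.tgt = x')) ∧
      (∀ τ, ∀ x, ∀ s ∈ path x, H τ s.bond = 0) ∧
      ∀ τ, fderiv ℝ (msChart F N K k (Bj M₁ Z k) (avgFamily (avOfRecord F N K) (1 : GaugeField (F.P K) 0 (SU N))) (1 : GaugeField (F.P K) 0 (SU N))) 0 (H τ) = τ :=
  exists_forest_rightInverse_Bj_of_surjective (Z := Z) hk hk1 (le_trans (by norm_num) hM2) hdiv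
    (surjective_fderiv_msChart_Bj_one (F := F) (N := N) (K := K) (k := k) hM2 hk (Z := Z) hdiv)

/-- ★★★ **THE FOREST RIGHT INVERSE AT EVERY GUARDED NEAR-FLAT BASE OF RECORD**: one rooted forest `path` ((F1), (F2), (TREE) at `R(𝐁_k(Z), k)`) and one radius `ρ′ > 0` such that at every
configuration `U₀` with `t₀`-small iterated averages below `k` (`stokesConst·t₀ < δ_N`) and `‖↑U₀ − 1‖ < ρ′`, the linearised constraint `DΦ_{U₀}(0)` of NODE 00's chart of record with its own datum
has a LINEAR right inverse VALUED IN THE FOREST SLICE — §3's curved-base section fed by dag-n10-w1's `surjective_fderiv_msChart_Bj`.  (dag-n12-w4's `hsurj`∕`Rf` for the tree gauge; the global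
near-flatness `‖↑U₀ − 1‖ < ρ′` is n10-w1's module-D guard — at the record's pinned minimiser only its LOCALISED form is inhabitable (dag-n12-w5's LOCATED-hU), which §3's exact curved-base statement
does not need once surjectivity at that `U₀` is known.) [cite: Balaban1985Variational, (45)–(48) p.285, (4) p.278; Balaban1985Averaging, (11) p.19, Prop. 3 p.36; Balaban1988Convergent, (2.13) pp.256–257] -/
theorem exists_forest_rightInverse_Bj_nearFlat_atRecord (hk : k ≤ (F.P K).m + (F.P K).K) (hk1 : 1 ≤ k) (hM2 : 2 ≤ M₁) (hdiv : side (F.P K).L M₁ k ∣ (F.P K).sitesPerDir 0) :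
    ∃ (path : Site (F.P K) 0 → List (LStep (F.P K) 0)) (ρ' : ℝ), 0 < ρ' ∧
      (∀ x, ∀ s ∈ path x, ∃ x' x'' : Site (F.P K) 0, path x'' = path x' ++ [s] ∧
        (s.fwd = true → s.bond.src = x' ∧ s.bond.tgt = x'') ∧ (s.fwd = false → s.bond.src = x'' ∧ s.bond.tgt = x')) ∧
      (∀ j, j ≤ k → ∀ c ∈ bondsOf ((Bj M₁ Z k : DetSet (F.P K)) j), path (embIter j c.src) = [] ∧ path (embIter j c.tgt) = []) ∧
      (∀ x : Site (F.P K) 0, x ∉ {z : Site (F.P K) 0 | ∃ j, j ≤ k ∧ ∃ c ∈ bondsOf ((Bj M₁ Z k : DetSet (F.P K)) j), (z = embIter j c.src ∨ z = embIter j c.tgt)} →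
        ∃ (x' : Site (F.P K) 0) (s : LStep (F.P K) 0), path x = path x' ++ [s] ∧
          (s.fwd = true → s.bond.src = x' ∧ s.bond.tgt = x) ∧ (s.fwd = false → s.bond.src = x ∧ s.bond.tgt = x')) ∧
      ∀ ⦃t₀ : ℝ⦄, 0 < t₀ → stokesConst (F.P K) * t₀ < deltaSU (Fin N) →
        ∀ U₀ : GaugeField (F.P K) 0 (SU N), (∀ i, i < k → PlaqSmall t₀ (Averaging.iter (avOfRecord F N K) i U₀)) → ‖coeField U₀ - 1‖ < ρ' →
          ∃ H : (Fin (constrCard (Bj M₁ Z k : DetSet (F.P K)) k) → lieSU (Fin N)) →ₗ[ℝ] (PBond (F.P K) 0 → lieSU (Fin N)),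
            (∀ τ, ∀ x, ∀ s ∈ path x, H τ s.bond = 0) ∧
            ∀ τ, fderiv ℝ (msChart F N K k (Bj M₁ Z k) (avgFamily (avOfRecord F N K) U₀) U₀) 0 (H τ) = τ := by
  obtain ⟨path, hF1, hF2, htree, hcurved⟩ := exists_forest_rightInverse_Bj_of_surjective_curved (F := F) (N := N) (Z := Z) hk hk1 (le_trans (by norm_num) hM2) hdiv
  obtain ⟨ρ', hρ', hsurj⟩ := surjective_fderiv_msChart_Bj (F := F) (N := N) (K := K) (k := k) hM2 hk (Z := Z) hdiv
  exact ⟨path, ρ', hρ', hF1, hF2, htree, fun t₀ ht₀ hstδ U₀ hsm hU => hcurved ht₀ hstδ U₀ hsm (hsurj ht₀ hstδ U₀ hsm hU)⟩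

end AtRecord

end Summit.QuantumFields.YangMills.BalabanUVNodes.N12ForestSliceCurved

end
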